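import Literature.NumberTheory.IwasawaTheory.ImaginaryQuadraticTwoTowerFerreroKidaTwoRamified
import Literature.NumberTheory.IwasawaTheory.ImaginaryQuadraticTwoTowerRootsOfUnity
import Literature.NumberTheory.IwasawaTheory.FerreroKidaLambdaTwoImaginaryQuadratic
import Literature.NumberTheory.EllipticCurves.CyclotomicZpExtensionLayerOneSqrtTwoProofs
import HarnessLib

/-!
# Ferrero 1980 / Kida 1979, `λ₂(ℚ(√−d)) + 1 = Σ_{p ∣ d, p ≠ 2} 2^{ord₂(p²−1)−3}`: the even case and the proof of the named fact

Topic `NumberTheory/IwasawaTheory`; namespace `Literature.NumberTheory.IwasawaTheory`.  Theorem-only file (no definition, no named fact,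
no `sorry`), unconditional.  It DISCHARGES the named fact `ferreroKida_classicalLambda_two_imaginaryQuadratic` (`FerreroKidaLambdaTwoImaginaryQuadratic.lean`):
`ferreroKida_classicalLambda_two_imaginaryQuadratic_holds`.

* `d ≡ 3 (mod 4)`: tree `ferreroKida_of_sq_eq_neg` (the `d_K` odd half, prover g31).
* `d ≡ 1 (mod 4)`: tree `classicalLambda_add_one_eq_ferreroKidaSum_of_mod_four_eq_one` (the `2`-ramified half: genus theory + capitulation kernel
  `{1, [𝔓_n]}` for the lower bound, Fukuda's step with the invariant non-square dyadic class for the upper bound).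
* `d = 2d′` even (§1–§2 here): `√2 ∈ ℚ_1`, so for every layer `n ≥ 1` the fields `ℚ(√−2d′)·ℚ_n` and `ℚ(√−d′)·ℚ_n` coincide inside `ℚ̄`; hence the two cyclotomic
  `ℤ₂`-towers have the same `e_n` for `n ≥ 1`, the same `λ`, and the Ferrero–Kida sums agree (`(2d′).primeFactors ∖ {2} = d′.primeFactors ∖ {2}`).  The field
  `K′ = ℚ(√−d′)` is realised as `ℚ⟮θ⟯ ⊆ ℚ̄`, `θ = e(δ)/s` with `s ∈ ℚ_1`, `s² = 2` (tree `exists_mem_layer_one_sq_eq_two_zpExtension`).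

## References

* B. Ferrero, *The cyclotomic ℤ₂-extension of imaginary quadratic fields*, Amer. J. Math. 102 (1980) 447–459. [Ferrero1980AJM]
* Y. Kida, *On cyclotomic ℤ₂-extensions of imaginary quadratic fields*, Tohoku Math. J. 31 (1979) 91–96. [Kida1979Tohoku]
* J. Schettler, *An alternative approach to Kida and Ferrero's computations of Iwasawa λ-invariants*, J. Number Theory 138 (2014), Thm. 2. [Schettler2014]
* L. C. Washington, *Introduction to Cyclotomic Fields*, GTM 83, Springer 1997, §13.1, §13.3. [Washington1997]
-/

noncomputable section

open NumberField IntermediateField Polynomial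

namespace Literature.NumberTheory.IwasawaTheory

open Literature.NumberTheory.EllipticCurves Literature.NumberTheory.EllipticCurves.ZpExtension
  Literature.NumberTheory.EllipticCurves.CoatesSujatha2005 Literature.NumberTheory.GaloisRepresentations
  Literature.NumberTheory.NumberFields

/-! ## §1 Quadratic fields: `K = ℚ(δ)` -/

/-- The minimal polynomial of a square root of a negative rational number over `ℚ` has degree `2` (auxiliary): `x² = −d < 0` is impossible for
`x ∈ ℚ`, and `X² + d` annihilates `x`. [folklore] -/
private theorem natDegree_minpoly_eq_two_of_sq_eq_neg {L : Type*} [Field L] [Algebra ℚ L] {d : ℕ} (hd : 0 < d) (x : L)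
    (hx : x ^ 2 = -((d : ℕ) : L)) (hint : IsIntegral ℚ x) : (minpoly ℚ x).natDegree = 2 := by
  have hle : (minpoly ℚ x).natDegree ≤ 2 := by
    have hp : (X ^ 2 + C (d : ℚ) : ℚ[X]) ≠ 0 := by
      apply_fun fun p => p.natDegree
      rw [natDegree_X_pow_add_C, natDegree_zero]; norm_num
    have hroot : Polynomial.aeval x (X ^ 2 + C (d : ℚ) : ℚ[X]) = 0 := by
      rw [map_add, map_pow, aeval_X, aeval_C, hx, map_natCast, neg_add_cancel]
    have h := minpoly.degree_le_of_ne_zero ℚ x hp hroot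
    rw [degree_X_pow_add_C (by norm_num)] at h
    exact natDegree_le_iff_degree_le.mpr h
  have hne : (minpoly ℚ x).natDegree ≠ 1 := by
    rw [Ne, minpoly.natDegree_eq_one_iff]
    rintro ⟨q, hq⟩
    have h1 : algebraMap ℚ L (q ^ 2) = algebraMap ℚ L (-(d : ℚ)) := by
      rw [map_pow, hq, hx, map_neg, map_natCast]
    have h2 : q ^ 2 = -(d : ℚ) := (algebraMap ℚ L).injective h1
    have h3 : (0 : ℚ) < d := by exact_mod_cast hd
    nlinarith [sq_nonneg q]
  have hpos : 0 < (minpoly ℚ x).natDegree := minpoly.natDegree_pos hint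
  omega

/-- **`K = ℚ(δ)`** for a quadratic number field `K ∋ δ`, `δ² = −d < 0` (auxiliary). [folklore] -/
private theorem adjoin_simple_eq_top_of_sq_eq_neg (K : Type) [Field K] [NumberField K] (hK2 : Module.finrank ℚ K = 2) {d : ℕ} (hd : 0 < d)
    (δ : K) (hδ : δ ^ 2 = -((d : ℕ) : K)) : ℚ⟮δ⟯ = ⊤ := by
  have hint : IsIntegral ℚ δ := IsIntegral.of_finite ℚ δ
  have hdeg := natDegree_minpoly_eq_two_of_sq_eq_neg hd δ hδ hint
  refine IntermediateField.eq_of_le_of_finrank_eq le_top ?_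
  rw [IntermediateField.adjoin.finrank hint, hdeg, IntermediateField.finrank_top', hK2]

/-! ## §2 The even case: `ℚ(√−2d′)·ℚ_n = ℚ(√−d′)·ℚ_n` for `n ≥ 1` -/

/-- ★ **`λ₂(ℚ(√−2d′)) = λ₂(ℚ(√−d′))`.**  For a number field `K` of degree `2` containing `δ` with `δ² = −2d′` (`d′ ≥ 1`) there is a number field `K′` of degree `2`
containing `η′` with `η′² = −d′` (namely `ℚ⟮e(δ)/√2⟯ ⊆ ℚ̄`, `√2 ∈ ℚ_1`) such that every cyclotomic `ℤ₂`-extension of `K` has the same `λ` as every cyclotomic `ℤ₂`-extension of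
`K′`: the layers `n ≥ 1` of the two towers are the same subfield `ℚ_n(√−d′) = ℚ_n(√−2d′)` of `ℚ̄`, so `e_n` agree for `n ≥ 1` and the eventual slopes coincide.
[cite: Washington1997, §13.1 and §13.3 Thm. 13.13] [cite: Schettler2014, Thm. 2] -/
theorem exists_quadratic_classicalLambda_eq_of_sq_eq_neg_two_mul (K : Type) [Field K] [NumberField K] (hK2 : Module.finrank ℚ K = 2) {d' : ℕ}
    (hd' : 0 < d') (hδ : ∃ δ : K, δ ^ 2 = -((2 * d' : ℕ) : K)) :
    ∃ (K' : Type) (_ : Field K') (_ : NumberField K'), Module.finrank ℚ K' = 2 ∧ (∃ η' : K', η' ^ 2 = -((d' : ℕ) : K')) ∧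
      ∀ (κ : ZpExtension K 2) (κ' : ZpExtension K' 2), κ.IsCyclotomic → κ'.IsCyclotomic → classicalLambda κ = classicalLambda κ' := by
  classical
  haveI : Fact (Nat.Prime 2) := ⟨Nat.prime_two⟩
  obtain ⟨δ, hδ⟩ := hδ
  have hcyc : (CyclotomicZp.zpExtension 2).IsCyclotomic := CyclotomicZp.isCyclotomic_zpExtension 2
  set j : K →ₐ[ℚ] AlgebraicClosure ℚ := absEmbedding ℚ K with hj
  obtain ⟨s, hs1, hs2⟩ := CyclotomicZp.exists_mem_layer_one_sq_eq_two_zpExtension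
  have hs0 : s ≠ 0 := fun h => by rw [h] at hs2; norm_num at hs2
  set θ : AlgebraicClosure ℚ := j δ * s⁻¹ with hθ
  have hjδ2 : (j δ) ^ 2 = -((2 * d' : ℕ) : AlgebraicClosure ℚ) := by rw [← map_pow, hδ, map_neg, map_natCast]
  have hθ2 : θ ^ 2 = -((d' : ℕ) : AlgebraicClosure ℚ) := by
    have h2 : (2 : AlgebraicClosure ℚ) ≠ 0 := two_ne_zero
    rw [hθ, mul_pow, inv_pow, hjδ2, hs2]
    push_cast
    field_simp
  have hjδ : j δ = θ * s := by rw [hθ, inv_mul_cancel_right₀ hs0]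
  -- `K' = ℚ⟮θ⟯`
  haveI : Algebra.IsAlgebraic ℚ (AlgebraicClosure ℚ) := AlgebraicClosure.isAlgebraic ℚ
  have hθint : IsIntegral ℚ θ := (Algebra.IsAlgebraic.isAlgebraic θ).isIntegral
  haveI : FiniteDimensional ℚ ℚ⟮θ⟯ := IntermediateField.adjoin.finiteDimensional hθint
  haveI hNF : NumberField ℚ⟮θ⟯ := @NumberField.mk _ _ inferInstance inferInstance
  have hK2' : Module.finrank ℚ ℚ⟮θ⟯ = 2 := by
    rw [IntermediateField.adjoin.finrank hθint, natDegree_minpoly_eq_two_of_sq_eq_neg hd' θ hθ2 hθint]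
  have hη' : (⟨θ, mem_adjoin_simple_self ℚ θ⟩ : ℚ⟮θ⟯) ^ 2 = -((d' : ℕ) : ℚ⟮θ⟯) := by
    apply Subtype.ext
    push_cast
    exact hθ2
  refine ⟨ℚ⟮θ⟯, inferInstance, hNF, hK2', ⟨_, hη'⟩, fun κ κ' hκ hκ' => ?_⟩
  -- the two restricted cyclotomic towers
  have hIQ : IsImaginaryQuadratic K := isImaginaryQuadratic_of_sq_eq_neg K hK2 (by omega) ⟨δ, hδ⟩
  have hIQ' : IsImaginaryQuadratic ℚ⟮θ⟯ := isImaginaryQuadratic_of_sq_eq_neg ℚ⟮θ⟯ hK2' hd' ⟨_, hη'⟩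
  have h := surjective_comp_absGaloisRestrict_imaginaryQuadratic_two hcyc K hIQ
  have h' := surjective_comp_absGaloisRestrict_imaginaryQuadratic_two hcyc ℚ⟮θ⟯ hIQ'
  have hκ₀c := isCyclotomic_restrict (CyclotomicZp.zpExtension 2) hcyc K h
  have hκ₀c' := isCyclotomic_restrict (CyclotomicZp.zpExtension 2) hcyc ℚ⟮θ⟯ h'
  have hμ₀' : ClassicalMuVanishes ((CyclotomicZp.zpExtension 2).restrict ℚ⟮θ⟯ h') :=
    classicalMuVanishes_imaginaryQuadratic_cyclotomic_two ℚ⟮θ⟯ hIQ' _ hκ₀c'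
  -- the layers `n ≥ 1` agree: `e(K)·ℚ_n = ℚ⟮θ⟯·ℚ_n`
  have hjr : j.fieldRange = ℚ⟮j δ⟯ := by
    rw [AlgHom.fieldRange_eq_map, ← adjoin_simple_eq_top_of_sq_eq_neg K hK2 (by omega : 0 < 2 * d') δ hδ, IntermediateField.adjoin_map,
      Set.image_singleton]
  have hEq : ∀ n, 1 ≤ n → j.fieldRange ⊔ (CyclotomicZp.zpExtension 2).layer n = (ℚ⟮θ⟯).val.fieldRange ⊔ (CyclotomicZp.zpExtension 2).layer n := by
    intro n hn
    have hsn : s ∈ (CyclotomicZp.zpExtension 2).layer n := (CyclotomicZp.zpExtension 2).layer_mono hn hs1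
    rw [hjr, IntermediateField.fieldRange_val]
    apply le_antisymm
    · refine sup_le (IntermediateField.adjoin_simple_le_iff.mpr ?_) le_sup_right
      rw [hjδ]
      exact mul_mem ((le_sup_left : ℚ⟮θ⟯ ≤ ℚ⟮θ⟯ ⊔ (CyclotomicZp.zpExtension 2).layer n) (mem_adjoin_simple_self ℚ θ))
        ((le_sup_right : (CyclotomicZp.zpExtension 2).layer n ≤ ℚ⟮θ⟯ ⊔ (CyclotomicZp.zpExtension 2).layer n) hsn)
    · refine sup_le (IntermediateField.adjoin_simple_le_iff.mpr ?_) le_sup_right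
      rw [hθ]
      exact mul_mem ((le_sup_left : ℚ⟮j δ⟯ ≤ ℚ⟮j δ⟯ ⊔ (CyclotomicZp.zpExtension 2).layer n) (mem_adjoin_simple_self ℚ (j δ)))
        (inv_mem ((le_sup_right : (CyclotomicZp.zpExtension 2).layer n ≤ ℚ⟮j δ⟯ ⊔ (CyclotomicZp.zpExtension 2).layer n) hsn))
  have he : ∀ n, 1 ≤ n → classNumberPExp ((CyclotomicZp.zpExtension 2).restrict K h) n =
      classNumberPExp ((CyclotomicZp.zpExtension 2).restrict ℚ⟮θ⟯ h') n := by
    intro n hn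
    haveI : FiniteDimensional K ↥(((CyclotomicZp.zpExtension 2).restrict K h).layer n) := ((CyclotomicZp.zpExtension 2).restrict K h).finiteDimensional_layer_holds n
    haveI : NumberField ↥(((CyclotomicZp.zpExtension 2).restrict K h).layer n) := NumberField.of_module_finite K _
    haveI : FiniteDimensional ℚ⟮θ⟯ ↥(((CyclotomicZp.zpExtension 2).restrict ℚ⟮θ⟯ h').layer n) :=
      ((CyclotomicZp.zpExtension 2).restrict ℚ⟮θ⟯ h').finiteDimensional_layer_holds n
    haveI : NumberField ↥(((CyclotomicZp.zpExtension 2).restrict ℚ⟮θ⟯ h').layer n) := NumberField.of_module_finite ℚ⟮θ⟯ _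
    obtain ⟨eK⟩ := nonempty_algEquiv_layer_restrict_fieldRange_sup_layer (CyclotomicZp.zpExtension 2) K h j n
    obtain ⟨eK'⟩ := nonempty_algEquiv_layer_restrict_fieldRange_sup_layer (CyclotomicZp.zpExtension 2) ℚ⟮θ⟯ h' (ℚ⟮θ⟯).val n
    have e : ↥(((CyclotomicZp.zpExtension 2).restrict K h).layer n) ≃+* ↥(((CyclotomicZp.zpExtension 2).restrict ℚ⟮θ⟯ h').layer n) :=
      eK.toRingEquiv.trans (((IntermediateField.equivOfEq (hEq n hn)).toRingEquiv).trans eK'.toRingEquiv.symm)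
    rw [classNumberPExp_def, classNumberPExp_def, Nat.card_congr (ClassGroup.mulEquiv (RingOfIntegers.mapRingEquiv e)).toEquiv]
  -- same growth law, same `λ`
  obtain ⟨ν, n₀, hgrowth⟩ := classicalLambda_spec _ hμ₀'
  have hlam : classicalLambda ((CyclotomicZp.zpExtension 2).restrict ℚ⟮θ⟯ h') = classicalLambda ((CyclotomicZp.zpExtension 2).restrict K h) :=
    eq_classicalLambda_of_growth _ (n₀ := max n₀ 1) fun n hn => by
      rw [he n (le_trans (le_max_right _ _) hn)]
      exact hgrowth n (le_trans (le_max_left _ _) hn)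
  rw [classicalLambda_eq_of_isCyclotomic κ _ hκ hκ₀c, classicalLambda_eq_of_isCyclotomic κ' _ hκ' hκ₀c', hlam]

/-! ## §3 The named fact -/

/-- The Ferrero–Kida sum only sees the odd prime factors: `Σ(2d′) = Σ(d′)`. [cite: Schettler2014, Thm. 2] -/
theorem ferreroKidaSum_two_mul {d' : ℕ} (hd' : d' ≠ 0) :
    (∑ p ∈ (2 * d').primeFactors.erase 2, 2 ^ (padicValNat 2 (p ^ 2 - 1) - 3)) =
      ∑ p ∈ d'.primeFactors.erase 2, 2 ^ (padicValNat 2 (p ^ 2 - 1) - 3) := by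
  rw [Nat.primeFactors_mul two_ne_zero hd', Nat.prime_two.primeFactors, ← Finset.insert_eq, Finset.erase_insert_eq_erase]

/-- ★★★ **FERRERO 1980 / KIDA 1979 (Schettler 2014, Thm. 2): `λ₂(ℚ(√−d)) + 1 = Σ_{p ∣ d, p ≠ 2} 2^{ord₂(p²−1)−3}` and `μ₂ = 0`, for every squarefree `d > 2` and every
cyclotomic `ℤ₂`-extension of `ℚ(√−d)`** — the named fact `ferreroKida_classicalLambda_two_imaginaryQuadratic`, PROVED: `d ≡ 3 (mod 4)` by the tree's
`ferreroKida_of_sq_eq_neg`, `d ≡ 1 (mod 4)` by `classicalLambda_add_one_eq_ferreroKidaSum_of_mod_four_eq_one`, `d` even by reduction to `d/2`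
(`exists_quadratic_classicalLambda_eq_of_sq_eq_neg_two_mul`), `μ = 0` by Ferrero–Washington for imaginary quadratic fields (tree
`classicalMuVanishes_imaginaryQuadratic_cyclotomic_two`). [cite: Ferrero1980AJM, Thm.] [cite: Kida1979Tohoku, Thm. 1] [cite: Schettler2014, Thm. 2] -/
theorem ferreroKida_classicalLambda_two_imaginaryQuadratic_holds : ferreroKida_classicalLambda_two_imaginaryQuadratic := by
  intro K _ _ d hsf hd2 hK2 hδ κ hκ
  haveI : Fact (Nat.Prime 2) := ⟨Nat.prime_two⟩
  rcases Nat.even_or_odd d with heven | hodd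
  · -- `d = 2 d'`
    obtain ⟨d', rfl⟩ : ∃ d', d = 2 * d' := ⟨d / 2, by obtain ⟨r, hr⟩ := heven; omega⟩
    have hd'0 : 0 < d' := by omega
    have hd'1 : d' ≠ 1 := by omega
    have hsf' : Squarefree d' := hsf.of_mul_right
    have hodd' : ¬ 2 ∣ d' := by
      rintro ⟨c, rfl⟩
      have h4 : (2 : ℕ) * 2 ∣ 2 * (2 * c) := ⟨c, by ring⟩
      have := hsf 2 h4
      rw [Nat.isUnit_iff] at this
      omega
    have hIQ : IsImaginaryQuadratic K := isImaginaryQuadratic_of_sq_eq_neg K hK2 (by omega) hδ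
    have hμ : ClassicalMuVanishes κ := classicalMuVanishes_imaginaryQuadratic_cyclotomic_two K hIQ κ hκ
    obtain ⟨K', _, _, hK2', hη', htransfer⟩ := exists_quadratic_classicalLambda_eq_of_sq_eq_neg_two_mul K hK2 hd'0 hδ
    have hcyc : (CyclotomicZp.zpExtension 2).IsCyclotomic := CyclotomicZp.isCyclotomic_zpExtension 2
    have hIQ' : IsImaginaryQuadratic K' := isImaginaryQuadratic_of_sq_eq_neg K' hK2' hd'0 hη'
    have h' := surjective_comp_absGaloisRestrict_imaginaryQuadratic_two hcyc K' hIQ'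
    have hκ₀c' := isCyclotomic_restrict (CyclotomicZp.zpExtension 2) hcyc K' h'
    have hFK' : classicalLambda ((CyclotomicZp.zpExtension 2).restrict K' h') + 1 = ∑ p ∈ d'.primeFactors.erase 2, 2 ^ (padicValNat 2 (p ^ 2 - 1) - 3) := by
      have h4 : d' % 4 = 1 ∨ d' % 4 = 3 := by omega
      rcases h4 with h4 | h4
      · exact (classicalLambda_add_one_eq_ferreroKidaSum_of_mod_four_eq_one K' hK2' hsf' h4 hd'1 hη' _ hκ₀c').2
      · exact (ferreroKida_of_sq_eq_neg K' hK2' hsf' h4 hη' _ hκ₀c').2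
    refine ⟨hμ, ?_⟩
    rw [ferreroKidaSum_two_mul hd'0.ne', htransfer κ _ hκ hκ₀c', hFK']
  · have h4 : d % 4 = 1 ∨ d % 4 = 3 := by obtain ⟨r, hr⟩ := hodd; omega
    rcases h4 with h4 | h4
    · exact classicalLambda_add_one_eq_ferreroKidaSum_of_mod_four_eq_one K hK2 hsf h4 (by omega) hδ κ hκ
    · exact ferreroKida_of_sq_eq_neg K hK2 hsf h4 hδ κ hκ

end Literature.NumberTheory.IwasawaTheory

end
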